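import Literature.NumberTheory.Rogawski1990.ArchSchwartzOrbitalIntegralConvergence   -- ★ p848470: (CONV) modulo `hvol`
import Literature.NumberTheory.Rogawski1990.TransferFactsCanonical                  -- ★ `OrbitalMeasureFamily.IsQuotientOf` ((W_H) of ★ `ArchCompatibleFamiliesH`)
import Literature.MeasureTheory.Group.InvariantQuotientCompactSubgroup             -- ★ `quotientMeasure_eq_inv_smul_map_mk` (compact subgroup)
import Literature.NumberTheory.Rogawski1990.ArchEllipticOrbitVolumeGrowth              -- ★ p848765 (LH3-p03): `haar_setOf_archHSGL_conj_le_of_elliptic_linear` (the `hgrp` input, unconditional) — ED. 2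
import Literature.NumberTheory.Rogawski1990.ArchEndoscopicStableClassCompactH           -- ★ `coe_centralizer_archH_eq_prod`, `compactSpace_arch_one_antidiagOne`, `isCompact_centralizer_singleton_of_isConj` — ED. 3
import Literature.NumberTheory.Rogawski1990.ArchUnitaryPlaneEigenframeCompact           -- ★ p847990 (LH3-p03): `isCompact_setOf_norm_apply_le_and_inv` — ED. 3
import HarnessLib

/-!
# (CONV) at the totally elliptic `G`-regular classes of `H_∞`: Schwartz orbital integrands are integrable for the Weil-form family,
# given the group-side volume growth of the orbit (Harish-Chandra; Beuzart-Plessis 2020 §1.5)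

Topic `NumberTheory/Rogawski1990`; namespace `Literature.NumberTheory.Rogawski1990`.  THEOREMS ONLY (no `def`, no instance, no notation, no axiom, no named fact,
no `sorry`).  Cell `pub/hodgecm-mathlib`, crux H413 (`stmt-HodgeConjecture-24833`), F0∕P3c line LH3, DEAL #11′ (CONV-ell-final) of LH3-plan (g0) (2026-09-02T03:31:59Z;
seat LH3-p04 (g0)) — the END-TO-END head of the (CONV)∕(VOL) chain at a class `c` of `H_∞ = U(Φ₂)(L⁺ ⊗ ℝ) × U(Φ₁)(L⁺ ⊗ ℝ)` whose centraliser is COMPACT (totally elliptic).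

* §1 `quotientMeasure_setOf_le_of_compact_of_group_bound` — GROUP-AGNOSTIC: for `Z ≤ G` closed and compact, `μ_{G∕Z} = ρ(Z)⁻¹ • π_* ν`
  (★ `quotientMeasure_eq_inv_smul_map_mk`), so a polynomial bound `ν{g ∣ P(ḡ) ≤ R} ≤ A R^e (1 + log R)^m` on the GROUP descends to the same bound (constant `A ∕ ρ(Z)`) for
  `μ_{G∕Z}{P ≤ R}`.
* §2 `integrable_orbitalIntegrand_of_archSchwartzGL_of_isQuotientOf` — for the Weil-form family `mH` ((W_H) of ★ `ArchCompatibleFamiliesH`: ★ `IsQuotientOf (IsArchGRegular L) νH tH`,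
  i.e. `mH c = dν_H ∕ dt_H` at every `G`-regular class), a `G`-regular class `c` with compact centraliser, `g ∈ 𝒞(H_∞)` (★ `ArchSchwartzGL L 3 𝔩 e ι_∞ g`, `e > 0`), and the
  GROUP-SIDE orbit growth `ν_H{y ∣ archHSGL(ι_∞(y γ y⁻¹)) ≤ R} ≤ A R^e (1 + log R)^m` at `γ = c.out` (LH3-p03's (VOL-ell-grp) head, hypothesis `hgrp` here): the orbital
  integrand ★ `descConj c.out Z(c.out) _ g` is `mH c`-integrable — §1 feeds the `hvol` of ★ `integrable_orbitalIntegrand_of_archSchwartzGL_of_volumeGrowth` (p848470).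
HONEST LABEL: HC_CM is proved only modulo the 7 printed citations (2 remaining: hLiu418 = stmt-HodgeConjecture-24832, h413 = stmt-HodgeConjecture-24833) until rung 0
closes; this file closes no organ — it certifies that the Schwartz orbital integrals in the LETTERS O1∕O3 of `stub_N9` are honest Bochner integrals at the totally elliptic
classes, modulo the named geometric input `hgrp`.

## References
* [BeuzartPlessis2020Asterisque] R. Beuzart-Plessis, *A local trace formula for the Gan–Gross–Prasad conjecture for unitary groups: the archimedean case*,
  Astérisque 418 (2020), §1.5 (1.5.2)–(1.5.3) p. 31.
* [Folland1995] G. B. Folland, *A Course in Abstract Harmonic Analysis* (1995), §2.6 Thm. 2.49, (2.52).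
* [Rogawski1990] J. D. Rogawski, *Automorphic Representations of Unitary Groups in Three Variables*, Ann. of Math. Stud. 123 (1990), §4.3 (4.3.1) p. 43; §1.7 p. 6.
-/

set_option autoImplicit false

noncomputable section

open MeasureTheory Set NumberField NumberField.mixedEmbedding
open Literature.MeasureTheory.Group Literature.NumberTheory.Automorphic
open scoped ENNReal MatrixGroups Matrix

namespace Literature.NumberTheory.Rogawski1990

/-! ## §1 Compact subgroup: a group-side polynomial bound descends to the quotient measure -/

section Compact

variable {G : Type*} [Group G] [TopologicalSpace G] [IsTopologicalGroup G] [LocallyCompactSpace G]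
  [SecondCountableTopology G] [T2Space G] [MeasurableSpace G] [BorelSpace G]

/-- **Compact `Z`: `μ_{G∕Z}{P ≤ R} = ρ(Z)⁻¹ · ν{g ∣ P(ḡ) ≤ R}`, so a group-side bound `A R^e (1 + log R)^m` descends with constant `A ∕ ρ(Z)`.**
(★ `quotientMeasure_eq_inv_smul_map_mk`.) [cite: Folland1995, §2.6 (2.52)] [cite: BeuzartPlessis2020Asterisque, §1.5 (1.5.2)–(1.5.3) p. 31] -/
theorem quotientMeasure_setOf_le_of_compact_of_group_bound
    (Z : Subgroup G) (hZ : IsClosed (Z : Set G)) [CompactSpace Z]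
    (ρ : Measure Z) [ρ.IsHaarMeasure] [ρ.IsInvInvariant] (ν : Measure G) [ν.IsHaarMeasure] [ν.IsMulRightInvariant]
    [MeasurableSpace (G ⧸ Z)] [BorelSpace (G ⧸ Z)]
    {P : G ⧸ Z → ℝ} (hP : Measurable P) {e : ℝ}
    (hgrp : ∃ (A : ℝ) (m : ℕ), ∀ R : ℝ, 1 ≤ R →
      ν {g : G | P (QuotientGroup.mk g) ≤ R} ≤ ENNReal.ofReal (A * R ^ e * (1 + Real.log R) ^ m)) :
    ∃ (A : ℝ) (m : ℕ), ∀ R : ℝ, 1 ≤ R →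
      quotientMeasure Z ρ hZ ν {x | P x ≤ R} ≤ ENNReal.ofReal (A * R ^ e * (1 + Real.log R) ^ m) := by
  haveI : IsClosed (Z : Set G) := hZ
  obtain ⟨A, m, hgrp⟩ := hgrp
  have hρ0 : ρ Set.univ ≠ 0 := (isOpen_univ.measure_pos ρ univ_nonempty).ne'
  have hρtop : ρ Set.univ ≠ ⊤ := (isCompact_univ.measure_lt_top (μ := ρ)).ne
  set c : ℝ := (ρ Set.univ).toReal⁻¹ with hc
  have hcpos : 0 < c := inv_pos.mpr (ENNReal.toReal_pos hρ0 hρtop)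
  have hcinv : (ρ Set.univ)⁻¹ = ENNReal.ofReal c := by
    rw [hc, ENNReal.ofReal_inv_of_pos (ENNReal.toReal_pos hρ0 hρtop), ENNReal.ofReal_toReal hρtop]
  set A' : ℝ := max A 0 with hA'
  refine ⟨c * A', m, fun R hR => ?_⟩
  have hR0 : 0 < R := lt_of_lt_of_le one_pos hR
  have hS : MeasurableSet {x : G ⧸ Z | P x ≤ R} := measurableSet_le hP measurable_const
  rw [quotientMeasure_eq_inv_smul_map_mk Z ρ ν, Measure.smul_apply, Measure.map_apply QuotientGroup.continuous_mk.measurable hS, smul_eq_mul,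
    hcinv]
  have hpre : (QuotientGroup.mk : G → G ⧸ Z) ⁻¹' {x : G ⧸ Z | P x ≤ R} = {g : G | P (QuotientGroup.mk g) ≤ R} := rfl
  rw [hpre]
  have hX0 : 0 ≤ R ^ e * (1 + Real.log R) ^ m :=
    mul_nonneg (Real.rpow_nonneg hR0.le e) (pow_nonneg (by linarith [Real.log_nonneg hR]) m)
  calc ENNReal.ofReal c * ν {g : G | P (QuotientGroup.mk g) ≤ R}
      ≤ ENNReal.ofReal c * ENNReal.ofReal (A' * R ^ e * (1 + Real.log R) ^ m) := by
        refine mul_le_mul' le_rfl ((hgrp R hR).trans (ENNReal.ofReal_le_ofReal ?_))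
        calc A * R ^ e * (1 + Real.log R) ^ m = A * (R ^ e * (1 + Real.log R) ^ m) := by ring
          _ ≤ A' * (R ^ e * (1 + Real.log R) ^ m) := mul_le_mul_of_nonneg_right (le_max_left _ _) hX0
          _ = A' * R ^ e * (1 + Real.log R) ^ m := by ring
    _ = ENNReal.ofReal (c * A' * R ^ e * (1 + Real.log R) ^ m) := by
        rw [← ENNReal.ofReal_mul hcpos.le]
        congr 1
        ring

end Compact

/-! ## §2 The end-to-end head on `H_∞` -/

section Endo

variable {L : Type} [Field L] [NumberField L] [IsCMField L]
    [MeasurableSpace ((↥(UnitaryGroup.arch (↥(maximalRealSubfield L)) L (IsCMField.complexConj L) 2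
          (Matrix.of fun i j : Fin 2 => if i.val + j.val + 1 = 2 then (1 : L) else 0)) ×
        ↥(UnitaryGroup.arch (↥(maximalRealSubfield L)) L (IsCMField.complexConj L) 1
          (Matrix.of fun i j : Fin 1 => if i.val + j.val + 1 = 1 then (1 : L) else 0))))]
    [BorelSpace ((↥(UnitaryGroup.arch (↥(maximalRealSubfield L)) L (IsCMField.complexConj L) 2
          (Matrix.of fun i j : Fin 2 => if i.val + j.val + 1 = 2 then (1 : L) else 0)) ×
        ↥(UnitaryGroup.arch (↥(maximalRealSubfield L)) L (IsCMField.complexConj L) 1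
          (Matrix.of fun i j : Fin 1 => if i.val + j.val + 1 = 1 then (1 : L) else 0))))]

/-- **(CONV) AT A TOTALLY ELLIPTIC `G`-REGULAR CLASS, END TO END.**  For the Weil-form family `mH` of ★ `ArchCompatibleFamiliesH` ((W_H) = ★ `IsQuotientOf (IsArchGRegular L) νH tH`:
`mH c = dν_H ∕ dt_H` at the `G`-regular classes), a `G`-regular class `c` whose centraliser is compact, a Schwartz `g` (★ `ArchSchwartzGL L 3 𝔩 e ι_∞ g`, `e > 0`) and the
group-side orbit growth `ν_H{y ∣ archHSGL(ι_∞(y·c.out·y⁻¹)) ≤ R} ≤ A R^e (1 + log R)^m` (LH3-p03's (VOL-ell-grp) head; at `e = 1∕2` for totally elliptic classes): the orbital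
integrand `y Z ↦ g(y c.out y⁻¹)` is `mH c`-integrable, i.e. ★ `classOrbitalIntegral mH g c` is an honest Bochner integral (§1 + ★ p848470).
[cite: BeuzartPlessis2020Asterisque, §1.5 (1.5.2)–(1.5.3) p. 31] [cite: Rogawski1990, §4.3 (4.3.1) p. 43; §1.7 p. 6] -/
theorem integrable_orbitalIntegrand_of_archSchwartzGL_of_isQuotientOf
    (νH : Measure ((↥(UnitaryGroup.arch (↥(maximalRealSubfield L)) L (IsCMField.complexConj L) 2
          (Matrix.of fun i j : Fin 2 => if i.val + j.val + 1 = 2 then (1 : L) else 0)) ×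
        ↥(UnitaryGroup.arch (↥(maximalRealSubfield L)) L (IsCMField.complexConj L) 1
          (Matrix.of fun i j : Fin 1 => if i.val + j.val + 1 = 1 then (1 : L) else 0)))))
    [νH.IsHaarMeasure] [νH.IsMulRightInvariant]
    [∀ a : (↥(UnitaryGroup.arch (↥(maximalRealSubfield L)) L (IsCMField.complexConj L) 2
          (Matrix.of fun i j : Fin 2 => if i.val + j.val + 1 = 2 then (1 : L) else 0)) ×
        ↥(UnitaryGroup.arch (↥(maximalRealSubfield L)) L (IsCMField.complexConj L) 1
          (Matrix.of fun i j : Fin 1 => if i.val + j.val + 1 = 1 then (1 : L) else 0))),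
      MeasurableSpace ((↥(UnitaryGroup.arch (↥(maximalRealSubfield L)) L (IsCMField.complexConj L) 2
          (Matrix.of fun i j : Fin 2 => if i.val + j.val + 1 = 2 then (1 : L) else 0)) ×
        ↥(UnitaryGroup.arch (↥(maximalRealSubfield L)) L (IsCMField.complexConj L) 1
          (Matrix.of fun i j : Fin 1 => if i.val + j.val + 1 = 1 then (1 : L) else 0))) ⧸ Subgroup.centralizer ({a} : Set _))]
    [∀ a : (↥(UnitaryGroup.arch (↥(maximalRealSubfield L)) L (IsCMField.complexConj L) 2
          (Matrix.of fun i j : Fin 2 => if i.val + j.val + 1 = 2 then (1 : L) else 0)) ×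
        ↥(UnitaryGroup.arch (↥(maximalRealSubfield L)) L (IsCMField.complexConj L) 1
          (Matrix.of fun i j : Fin 1 => if i.val + j.val + 1 = 1 then (1 : L) else 0))),
      BorelSpace ((↥(UnitaryGroup.arch (↥(maximalRealSubfield L)) L (IsCMField.complexConj L) 2
          (Matrix.of fun i j : Fin 2 => if i.val + j.val + 1 = 2 then (1 : L) else 0)) ×
        ↥(UnitaryGroup.arch (↥(maximalRealSubfield L)) L (IsCMField.complexConj L) 1
          (Matrix.of fun i j : Fin 1 => if i.val + j.val + 1 = 1 then (1 : L) else 0))) ⧸ Subgroup.centralizer ({a} : Set _))]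
    (tH : ∀ γH : (↥(UnitaryGroup.arch (↥(maximalRealSubfield L)) L (IsCMField.complexConj L) 2
          (Matrix.of fun i j : Fin 2 => if i.val + j.val + 1 = 2 then (1 : L) else 0)) ×
        ↥(UnitaryGroup.arch (↥(maximalRealSubfield L)) L (IsCMField.complexConj L) 1
          (Matrix.of fun i j : Fin 1 => if i.val + j.val + 1 = 1 then (1 : L) else 0))),
      Measure ↥(Subgroup.centralizer ({γH} : Set _)))
    (mH : OrbitalMeasureFamily ((↥(UnitaryGroup.arch (↥(maximalRealSubfield L)) L (IsCMField.complexConj L) 2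
          (Matrix.of fun i j : Fin 2 => if i.val + j.val + 1 = 2 then (1 : L) else 0)) ×
        ↥(UnitaryGroup.arch (↥(maximalRealSubfield L)) L (IsCMField.complexConj L) 1
          (Matrix.of fun i j : Fin 1 => if i.val + j.val + 1 = 1 then (1 : L) else 0)))))
    (hW : mH.IsQuotientOf (IsArchGRegular L) νH tH)
    (𝔩 : Set (Matrix (Fin 3) (Fin 3) (mixedSpace L))) {e : ℝ} (he : 0 < e)
    {g : (↥(UnitaryGroup.arch (↥(maximalRealSubfield L)) L (IsCMField.complexConj L) 2
          (Matrix.of fun i j : Fin 2 => if i.val + j.val + 1 = 2 then (1 : L) else 0)) ×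
        ↥(UnitaryGroup.arch (↥(maximalRealSubfield L)) L (IsCMField.complexConj L) 1
          (Matrix.of fun i j : Fin 1 => if i.val + j.val + 1 = 1 then (1 : L) else 0))) → ℂ}
    (hg : ArchSchwartzGL L 3 𝔩 e (fun k => ((endoEmbArch L k).val : GL (Fin 3) (mixedSpace L))) g)
    (c : ConjClasses ((↥(UnitaryGroup.arch (↥(maximalRealSubfield L)) L (IsCMField.complexConj L) 2
          (Matrix.of fun i j : Fin 2 => if i.val + j.val + 1 = 2 then (1 : L) else 0)) ×
        ↥(UnitaryGroup.arch (↥(maximalRealSubfield L)) L (IsCMField.complexConj L) 1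
          (Matrix.of fun i j : Fin 1 => if i.val + j.val + 1 = 1 then (1 : L) else 0)))))
    (hc : IsArchGRegular L (Quotient.out c))
    [CompactSpace ↥(Subgroup.centralizer ({Quotient.out c} : Set ((↥(UnitaryGroup.arch (↥(maximalRealSubfield L)) L (IsCMField.complexConj L) 2
          (Matrix.of fun i j : Fin 2 => if i.val + j.val + 1 = 2 then (1 : L) else 0)) ×
        ↥(UnitaryGroup.arch (↥(maximalRealSubfield L)) L (IsCMField.complexConj L) 1
          (Matrix.of fun i j : Fin 1 => if i.val + j.val + 1 = 1 then (1 : L) else 0))))))]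
    (hgrp : ∃ (A : ℝ) (m : ℕ), ∀ R : ℝ, 1 ≤ R →
      νH {y | archHSGL L 3 ((endoEmbArch L (y * Quotient.out c * y⁻¹)).val : GL (Fin 3) (mixedSpace L)) ≤ R} ≤
        ENNReal.ofReal (A * R ^ e * (1 + Real.log R) ^ m)) :
    Integrable (descConj (Quotient.out c) (Subgroup.centralizer ({Quotient.out c} : Set _))
      (fun _ h => Subgroup.mem_centralizer_singleton_iff.1 h) g) (mH c) := by
  -- (W_H) at the `G`-regular class `c`
  obtain ⟨hHaar, hInv, hmc⟩ := hW c hc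
  refine integrable_orbitalIntegrand_of_archSchwartzGL_of_volumeGrowth 𝔩 he hg mH c ?_
  rw [hmc]
  -- continuity ⇒ measurability of the orbit radius on the quotient
  have hι : Continuous fun k : (↥(UnitaryGroup.arch (↥(maximalRealSubfield L)) L (IsCMField.complexConj L) 2
          (Matrix.of fun i j : Fin 2 => if i.val + j.val + 1 = 2 then (1 : L) else 0)) ×
        ↥(UnitaryGroup.arch (↥(maximalRealSubfield L)) L (IsCMField.complexConj L) 1
          (Matrix.of fun i j : Fin 1 => if i.val + j.val + 1 = 1 then (1 : L) else 0))) =>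
      archHSGL L 3 ((endoEmbArch L k).val : GL (Fin 3) (mixedSpace L)) := by
    have h3 : Continuous (archHSGL L 3) := by
      unfold archHSGL
      exact continuous_archHSWeightGL L 3
    exact h3.comp (continuous_subtype_val.comp (continuous_endoEmbArch L))
  have hP : Measurable (descConj (Quotient.out c) (Subgroup.centralizer ({Quotient.out c} : Set _))
      (fun _ h => Subgroup.mem_centralizer_singleton_iff.1 h)
      (fun y => archHSGL L 3 ((endoEmbArch L y).val : GL (Fin 3) (mixedSpace L)))) :=
    (continuous_descConj _ _ _ hι).measurable
  exact quotientMeasure_setOf_le_of_compact_of_group_bound _ _ (tH (Quotient.out c)) νH hP hgrp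

/-- **(CONV) AT A TOTALLY ELLIPTIC `G`-REGULAR CLASS — UNCONDITIONAL IN THE GEOMETRY (ED. 2).**  Same as `integrable_orbitalIntegrand_of_archSchwartzGL_of_isQuotientOf` at the
`Ξ`-exponent `e = 1∕2` of `H_∞`, with the group-side orbit growth DISCHARGED by LH3-p03's ★ `haar_setOf_archHSGL_conj_le_of_elliptic_linear` (p848765) under its
total-ellipticity token `hell` (at every complex place the component of `c.out` is a `U(Φ₂)_w`-conjugate of a regular point of the compact torus ★ `torusMatrix`); the
compactness of the centraliser stays an instance hypothesis.  So: for the Weil-form family of (W_H), every Schwartz `g` (★ `ArchSchwartzGL L 3 𝔩 (1∕2) ι_∞ g`, e.g.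
LH3's `ArchSchwartzEndo`) has an honest Bochner orbital integral at every totally elliptic `G`-regular class. [cite: BeuzartPlessis2020Asterisque, §1.5 (1.5.2)–(1.5.3) p. 31]
[cite: Rogawski1990, §4.3 (4.3.1) p. 43; §1.7 p. 6] -/
theorem integrable_orbitalIntegrand_of_archSchwartzGL_of_totallyElliptic
    (νH : Measure ((↥(UnitaryGroup.arch (↥(maximalRealSubfield L)) L (IsCMField.complexConj L) 2
          (Matrix.of fun i j : Fin 2 => if i.val + j.val + 1 = 2 then (1 : L) else 0)) ×
        ↥(UnitaryGroup.arch (↥(maximalRealSubfield L)) L (IsCMField.complexConj L) 1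
          (Matrix.of fun i j : Fin 1 => if i.val + j.val + 1 = 1 then (1 : L) else 0)))))
    [νH.IsHaarMeasure] [νH.IsMulRightInvariant]
    [∀ a : (↥(UnitaryGroup.arch (↥(maximalRealSubfield L)) L (IsCMField.complexConj L) 2
          (Matrix.of fun i j : Fin 2 => if i.val + j.val + 1 = 2 then (1 : L) else 0)) ×
        ↥(UnitaryGroup.arch (↥(maximalRealSubfield L)) L (IsCMField.complexConj L) 1
          (Matrix.of fun i j : Fin 1 => if i.val + j.val + 1 = 1 then (1 : L) else 0))),
      MeasurableSpace ((↥(UnitaryGroup.arch (↥(maximalRealSubfield L)) L (IsCMField.complexConj L) 2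
          (Matrix.of fun i j : Fin 2 => if i.val + j.val + 1 = 2 then (1 : L) else 0)) ×
        ↥(UnitaryGroup.arch (↥(maximalRealSubfield L)) L (IsCMField.complexConj L) 1
          (Matrix.of fun i j : Fin 1 => if i.val + j.val + 1 = 1 then (1 : L) else 0))) ⧸ Subgroup.centralizer ({a} : Set _))]
    [∀ a : (↥(UnitaryGroup.arch (↥(maximalRealSubfield L)) L (IsCMField.complexConj L) 2
          (Matrix.of fun i j : Fin 2 => if i.val + j.val + 1 = 2 then (1 : L) else 0)) ×
        ↥(UnitaryGroup.arch (↥(maximalRealSubfield L)) L (IsCMField.complexConj L) 1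
          (Matrix.of fun i j : Fin 1 => if i.val + j.val + 1 = 1 then (1 : L) else 0))),
      BorelSpace ((↥(UnitaryGroup.arch (↥(maximalRealSubfield L)) L (IsCMField.complexConj L) 2
          (Matrix.of fun i j : Fin 2 => if i.val + j.val + 1 = 2 then (1 : L) else 0)) ×
        ↥(UnitaryGroup.arch (↥(maximalRealSubfield L)) L (IsCMField.complexConj L) 1
          (Matrix.of fun i j : Fin 1 => if i.val + j.val + 1 = 1 then (1 : L) else 0))) ⧸ Subgroup.centralizer ({a} : Set _))]
    (tH : ∀ γH : (↥(UnitaryGroup.arch (↥(maximalRealSubfield L)) L (IsCMField.complexConj L) 2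
          (Matrix.of fun i j : Fin 2 => if i.val + j.val + 1 = 2 then (1 : L) else 0)) ×
        ↥(UnitaryGroup.arch (↥(maximalRealSubfield L)) L (IsCMField.complexConj L) 1
          (Matrix.of fun i j : Fin 1 => if i.val + j.val + 1 = 1 then (1 : L) else 0))),
      Measure ↥(Subgroup.centralizer ({γH} : Set _)))
    (mH : OrbitalMeasureFamily ((↥(UnitaryGroup.arch (↥(maximalRealSubfield L)) L (IsCMField.complexConj L) 2
          (Matrix.of fun i j : Fin 2 => if i.val + j.val + 1 = 2 then (1 : L) else 0)) ×
        ↥(UnitaryGroup.arch (↥(maximalRealSubfield L)) L (IsCMField.complexConj L) 1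
          (Matrix.of fun i j : Fin 1 => if i.val + j.val + 1 = 1 then (1 : L) else 0)))))
    (hW : mH.IsQuotientOf (IsArchGRegular L) νH tH)
    (𝔩 : Set (Matrix (Fin 3) (Fin 3) (mixedSpace L)))
    {g : (↥(UnitaryGroup.arch (↥(maximalRealSubfield L)) L (IsCMField.complexConj L) 2
          (Matrix.of fun i j : Fin 2 => if i.val + j.val + 1 = 2 then (1 : L) else 0)) ×
        ↥(UnitaryGroup.arch (↥(maximalRealSubfield L)) L (IsCMField.complexConj L) 1
          (Matrix.of fun i j : Fin 1 => if i.val + j.val + 1 = 1 then (1 : L) else 0))) → ℂ}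
    (hg : ArchSchwartzGL L 3 𝔩 (1 / (2 : ℝ)) (fun k => ((endoEmbArch L k).val : GL (Fin 3) (mixedSpace L))) g)
    (c : ConjClasses ((↥(UnitaryGroup.arch (↥(maximalRealSubfield L)) L (IsCMField.complexConj L) 2
          (Matrix.of fun i j : Fin 2 => if i.val + j.val + 1 = 2 then (1 : L) else 0)) ×
        ↥(UnitaryGroup.arch (↥(maximalRealSubfield L)) L (IsCMField.complexConj L) 1
          (Matrix.of fun i j : Fin 1 => if i.val + j.val + 1 = 1 then (1 : L) else 0)))))
    (hc : IsArchGRegular L (Quotient.out c))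
    [CompactSpace ↥(Subgroup.centralizer ({Quotient.out c} : Set ((↥(UnitaryGroup.arch (↥(maximalRealSubfield L)) L (IsCMField.complexConj L) 2
          (Matrix.of fun i j : Fin 2 => if i.val + j.val + 1 = 2 then (1 : L) else 0)) ×
        ↥(UnitaryGroup.arch (↥(maximalRealSubfield L)) L (IsCMField.complexConj L) 1
          (Matrix.of fun i j : Fin 1 => if i.val + j.val + 1 = 1 then (1 : L) else 0))))))]
    (hell : ∀ w : {w : InfinitePlace L // w.IsComplex},
      ∃ (g₀ : ↥(UnitaryGroup.archLocal L 2 (Matrix.of fun i j : Fin 2 => if i.val + j.val + 1 = 2 then (1 : L) else 0) w)) (l₁ l₂ : ℂ), l₁ ≠ l₂ ∧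
        (((UnitaryGroup.archPiEquivCM 2 L (Matrix.of fun i j : Fin 2 => if i.val + j.val + 1 = 2 then (1 : L) else 0) (Quotient.out c).1 w :
            ↥(UnitaryGroup.archLocal L 2 (Matrix.of fun i j : Fin 2 => if i.val + j.val + 1 = 2 then (1 : L) else 0) w)) : GL (Fin 2) ℂ) : Matrix (Fin 2) (Fin 2) ℂ) =
          ((g₀ : GL (Fin 2) ℂ) : Matrix (Fin 2) (Fin 2) ℂ) * torusMatrix l₁ l₂ * (((g₀ : GL (Fin 2) ℂ)) : Matrix (Fin 2) (Fin 2) ℂ)⁻¹) :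
    Integrable (descConj (Quotient.out c) (Subgroup.centralizer ({Quotient.out c} : Set _))
      (fun _ h => Subgroup.mem_centralizer_singleton_iff.1 h) g) (mH c) :=
  integrable_orbitalIntegrand_of_archSchwartzGL_of_isQuotientOf νH tH mH hW 𝔩 (by norm_num) hg c hc
    (haar_setOf_archHSGL_conj_le_of_elliptic_linear L νH (Quotient.out c) hell)

end Endo

/-! ## §3 (ED. 3) The centraliser of a totally elliptic `G`-regular element is COMPACT — the `[CompactSpace Z(c.out)]` binder discharged from `hell` -/

section CompactCentralizer

open scoped ComplexConjugate Classical

variable {L : Type} [Field L] [NumberField L] [IsCMField L]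

/-- A `Φ₂`-unitary `2 × 2` matrix commuting with a REGULAR compact-torus point `torusMatrix l₁ l₂` (`l₁ ≠ l₂`) has all entries of modulus `≤ 1` (it is `(a b; b a)` with
`|a|² + |b|² = 1`). [cite: Rogawski1990, §4.6 Prop. 4.6.1; §3.1 p. 19] -/
theorem norm_apply_le_one_of_unitary_commute_torusMatrix {y : Matrix (Fin 2) (Fin 2) ℂ}
    (hy : (y.map (starRingEnd ℂ))ᵀ * (Matrix.of fun i j : Fin 2 => if i.val + j.val + 1 = 2 then (1 : ℂ) else 0) * y =
      (Matrix.of fun i j : Fin 2 => if i.val + j.val + 1 = 2 then (1 : ℂ) else 0))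
    {l₁ l₂ : ℂ} (hne : l₁ ≠ l₂) (hc : y * torusMatrix l₁ l₂ = torusMatrix l₁ l₂ * y) (i j : Fin 2) : ‖y i j‖ ≤ 1 := by
  obtain ⟨-, h01, -, -⟩ := archPlane_unitarity_relations hy
  have hd : (l₁ - l₂) / 2 ≠ 0 := div_ne_zero (sub_ne_zero.2 hne) two_ne_zero
  have e00 := congrFun (congrFun hc 0) 0
  have e01 := congrFun (congrFun hc 0) 1
  simp [Matrix.mul_apply, torusMatrix, Fin.sum_univ_two] at e00 e01
  have hsym1 : y 0 1 = y 1 0 := by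
    have h : (l₁ - l₂) / 2 * (y 0 1 - y 1 0) = 0 := by linear_combination e00
    rcases mul_eq_zero.1 h with h | h
    · exact absurd h hd
    · exact sub_eq_zero.1 h
  have hsym2 : y 0 0 = y 1 1 := by
    have h : (l₁ - l₂) / 2 * (y 0 0 - y 1 1) = 0 := by linear_combination e01
    rcases mul_eq_zero.1 h with h | h
    · exact absurd h hd
    · exact sub_eq_zero.1 h
  have hsum : Complex.normSq (y 0 0) + Complex.normSq (y 0 1) = 1 := by
    have h : conj (y 0 0) * y 0 0 + conj (y 0 1) * y 0 1 = 1 := by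
      have h' := h01
      rw [← hsym1, ← hsym2] at h'
      exact h'
    rw [← Complex.normSq_eq_conj_mul_self, ← Complex.normSq_eq_conj_mul_self] at h
    exact_mod_cast h
  have h0 : ‖y 0 0‖ ≤ 1 := by
    rw [← sq_le_one_iff₀ (norm_nonneg _), Complex.sq_norm]
    nlinarith [Complex.normSq_nonneg (y 0 1)]
  have h1 : ‖y 0 1‖ ≤ 1 := by
    rw [← sq_le_one_iff₀ (norm_nonneg _), Complex.sq_norm]
    nlinarith [Complex.normSq_nonneg (y 0 0)]
  fin_cases i <;> fin_cases j
  · exact h0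
  · exact h1
  · simpa [← hsym1] using h1
  · simpa [← hsym2] using h0

omit [NumberField L] [IsCMField L] in
/-- **Per place: the centraliser in `U(Φ₂)(ℂ)_w` of a conjugate of a regular compact-torus point is compact** (it is conjugate to `Z(torusMatrix l₁ l₂) = T_c`, whose elements and
their inverses have entries of modulus `≤ 1`: a closed subset of the compact ★ `isCompact_setOf_norm_apply_le_and_inv`). [cite: Rogawski1990, §3.1 p. 19; §4.6 Prop. 4.6.1]
[cite: BrockerTomDieck1985, Ch. IV (3.1)] -/
theorem isCompact_centralizer_archLocal_of_conj_torusMatrix (w : {w : InfinitePlace L // w.IsComplex})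
    (γw g₀ : ↥(UnitaryGroup.archLocal L 2 (Matrix.of fun i j : Fin 2 => if i.val + j.val + 1 = 2 then (1 : L) else 0) w)) {l₁ l₂ : ℂ} (hne : l₁ ≠ l₂)
    (hγ : ((γw : GL (Fin 2) ℂ) : Matrix (Fin 2) (Fin 2) ℂ) =
      ((g₀ : GL (Fin 2) ℂ) : Matrix (Fin 2) (Fin 2) ℂ) * torusMatrix l₁ l₂ * (((g₀ : GL (Fin 2) ℂ)) : Matrix (Fin 2) (Fin 2) ℂ)⁻¹) :
    IsCompact ((Subgroup.centralizer ({γw} : Set ↥(UnitaryGroup.archLocal L 2 (Matrix.of fun i j : Fin 2 => if i.val + j.val + 1 = 2 then (1 : L) else 0) w))) :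
      Set ↥(UnitaryGroup.archLocal L 2 (Matrix.of fun i j : Fin 2 => if i.val + j.val + 1 = 2 then (1 : L) else 0) w)) := by
  set t₀ : ↥(UnitaryGroup.archLocal L 2 (Matrix.of fun i j : Fin 2 => if i.val + j.val + 1 = 2 then (1 : L) else 0) w) := g₀⁻¹ * γw * g₀ with ht₀def
  have hu : IsUnit (((g₀ : GL (Fin 2) ℂ) : Matrix (Fin 2) (Fin 2) ℂ)).det := Matrix.isUnits_det_units _
  have ht₀ : ((t₀ : GL (Fin 2) ℂ) : Matrix (Fin 2) (Fin 2) ℂ) = torusMatrix l₁ l₂ := by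
    simp only [ht₀def, Subgroup.coe_mul, Subgroup.coe_inv, Units.val_mul, Matrix.coe_units_inv, hγ]
    rw [show (((g₀ : GL (Fin 2) ℂ) : Matrix (Fin 2) (Fin 2) ℂ))⁻¹ * ((((g₀ : GL (Fin 2) ℂ) : Matrix (Fin 2) (Fin 2) ℂ)) * torusMatrix l₁ l₂ *
        (((g₀ : GL (Fin 2) ℂ) : Matrix (Fin 2) (Fin 2) ℂ))⁻¹) * ((g₀ : GL (Fin 2) ℂ) : Matrix (Fin 2) (Fin 2) ℂ) =
        ((((g₀ : GL (Fin 2) ℂ) : Matrix (Fin 2) (Fin 2) ℂ))⁻¹ * ((g₀ : GL (Fin 2) ℂ) : Matrix (Fin 2) (Fin 2) ℂ)) * torusMatrix l₁ l₂ *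
        ((((g₀ : GL (Fin 2) ℂ) : Matrix (Fin 2) (Fin 2) ℂ))⁻¹ * ((g₀ : GL (Fin 2) ℂ) : Matrix (Fin 2) (Fin 2) ℂ)) by simp only [Matrix.mul_assoc],
      Matrix.nonsing_inv_mul _ hu, Matrix.one_mul, Matrix.mul_one]
  have hconj : IsConj t₀ γw := isConj_iff.2 ⟨g₀, by rw [ht₀def]; group⟩
  refine isCompact_centralizer_singleton_of_isConj hconj ?_
  -- entries of every element of `Z(t₀)` have modulus ≤ 1
  have key : ∀ z ∈ Subgroup.centralizer ({t₀} : Set ↥(UnitaryGroup.archLocal L 2 (Matrix.of fun i j : Fin 2 => if i.val + j.val + 1 = 2 then (1 : L) else 0) w)),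
      ∀ i j : Fin 2, ‖((z : GL (Fin 2) ℂ) : Matrix (Fin 2) (Fin 2) ℂ) i j‖ ≤ 1 := by
    intro z hz i j
    have hzu := (UnitaryGroup.mem_archLocal_iff L 2 (Matrix.of fun i j : Fin 2 => if i.val + j.val + 1 = 2 then (1 : L) else 0) w _).1 z.2
    rw [antidiagOne_map] at hzu
    have hcomm : ((z : GL (Fin 2) ℂ) : Matrix (Fin 2) (Fin 2) ℂ) * torusMatrix l₁ l₂ = torusMatrix l₁ l₂ * ((z : GL (Fin 2) ℂ) : Matrix (Fin 2) (Fin 2) ℂ) := by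
      have h1 : z * t₀ = t₀ * z := Subgroup.mem_centralizer_singleton_iff.1 hz
      have h2 := congrArg (fun u : ↥(UnitaryGroup.archLocal L 2 (Matrix.of fun i j : Fin 2 => if i.val + j.val + 1 = 2 then (1 : L) else 0) w) =>
        ((u : GL (Fin 2) ℂ) : Matrix (Fin 2) (Fin 2) ℂ)) h1
      simpa only [Subgroup.coe_mul, Units.val_mul, ht₀] using h2
    exact norm_apply_le_one_of_unitary_commute_torusMatrix hzu hne hcomm i j
  -- compactness through the closed embedding into `GL₂(ℂ)`
  refine Topology.IsInducing.subtypeVal.isCompact_iff.mpr ((isCompact_setOf_norm_apply_le_and_inv (N := 2) (1 : ℝ)).of_isClosed_subset ?_ ?_)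
  · exact (Topology.IsClosedEmbedding.subtypeVal (UnitaryGroup.isClosed_archLocal L 2 (Matrix.of fun i j : Fin 2 => if i.val + j.val + 1 = 2 then (1 : L) else 0) w)).isClosedMap
      _ (isClosed_coe_centralizer_singleton t₀)
  · rintro _ ⟨z, hz, rfl⟩ i j
    exact ⟨key z hz i j, by simpa only [Subgroup.coe_inv] using key z⁻¹ (inv_mem hz) i j⟩

/-- **The centraliser in `H_∞` of a TOTALLY ELLIPTIC `G`-regular element is compact**: `Z_{H_∞}(γ) = Z(γ₂) × U(Φ₁)_∞` (★ `coe_centralizer_archH_eq_prod`), `U(Φ₁)_∞` compact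
(★ `compactSpace_arch_one_antidiagOne`), and `Z(γ₂) ≅ Π_w Z_w(γ_{2,w})` through ★ `archPiEquivCM` with every factor compact (previous lemma).
[cite: Rogawski1990, §3.1 p. 19; §14.3 p. 234] [cite: PlatonovRapinchuk1994, §3.2 Thm 3.1] -/
theorem isCompact_centralizer_of_totallyElliptic
    (γ : (↥(UnitaryGroup.arch (↥(maximalRealSubfield L)) L (IsCMField.complexConj L) 2
          (Matrix.of fun i j : Fin 2 => if i.val + j.val + 1 = 2 then (1 : L) else 0)) ×
        ↥(UnitaryGroup.arch (↥(maximalRealSubfield L)) L (IsCMField.complexConj L) 1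
          (Matrix.of fun i j : Fin 1 => if i.val + j.val + 1 = 1 then (1 : L) else 0))))
    (hell : ∀ w : {w : InfinitePlace L // w.IsComplex},
      ∃ (g₀ : ↥(UnitaryGroup.archLocal L 2 (Matrix.of fun i j : Fin 2 => if i.val + j.val + 1 = 2 then (1 : L) else 0) w)) (l₁ l₂ : ℂ), l₁ ≠ l₂ ∧
        (((UnitaryGroup.archPiEquivCM 2 L (Matrix.of fun i j : Fin 2 => if i.val + j.val + 1 = 2 then (1 : L) else 0) γ.1 w :
            ↥(UnitaryGroup.archLocal L 2 (Matrix.of fun i j : Fin 2 => if i.val + j.val + 1 = 2 then (1 : L) else 0) w)) : GL (Fin 2) ℂ) : Matrix (Fin 2) (Fin 2) ℂ) =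
          ((g₀ : GL (Fin 2) ℂ) : Matrix (Fin 2) (Fin 2) ℂ) * torusMatrix l₁ l₂ * (((g₀ : GL (Fin 2) ℂ)) : Matrix (Fin 2) (Fin 2) ℂ)⁻¹) :
    IsCompact ((Subgroup.centralizer ({γ} : Set ((↥(UnitaryGroup.arch (↥(maximalRealSubfield L)) L (IsCMField.complexConj L) 2
          (Matrix.of fun i j : Fin 2 => if i.val + j.val + 1 = 2 then (1 : L) else 0)) ×
        ↥(UnitaryGroup.arch (↥(maximalRealSubfield L)) L (IsCMField.complexConj L) 1
          (Matrix.of fun i j : Fin 1 => if i.val + j.val + 1 = 1 then (1 : L) else 0)))))) : Set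
      ((↥(UnitaryGroup.arch (↥(maximalRealSubfield L)) L (IsCMField.complexConj L) 2
          (Matrix.of fun i j : Fin 2 => if i.val + j.val + 1 = 2 then (1 : L) else 0)) ×
        ↥(UnitaryGroup.arch (↥(maximalRealSubfield L)) L (IsCMField.complexConj L) 1
          (Matrix.of fun i j : Fin 1 => if i.val + j.val + 1 = 1 then (1 : L) else 0))))) := by
  haveI := compactSpace_arch_one_antidiagOne L
  rw [coe_centralizer_archH_eq_prod L γ]
  refine IsCompact.prod ?_ isCompact_univ
  set e := UnitaryGroup.archPiEquivCM 2 L (Matrix.of fun i j : Fin 2 => if i.val + j.val + 1 = 2 then (1 : L) else 0) with he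
  have hZ : ((Subgroup.centralizer ({γ.1} : Set ↥(UnitaryGroup.arch (↥(maximalRealSubfield L)) L (IsCMField.complexConj L) 2
        (Matrix.of fun i j : Fin 2 => if i.val + j.val + 1 = 2 then (1 : L) else 0)))) : Set _) =
      e ⁻¹' Set.pi Set.univ (fun w => ((Subgroup.centralizer ({e γ.1 w} : Set ↥(UnitaryGroup.archLocal L 2 (Matrix.of fun i j : Fin 2 => if i.val + j.val + 1 = 2 then (1 : L) else 0) w))) : Set _)) := by
    ext y
    simp only [SetLike.mem_coe, Subgroup.mem_centralizer_singleton_iff, Set.mem_preimage, Set.mem_univ_pi]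
    constructor
    · intro h w
      have h' := congrArg (fun z => e z w) h
      simpa only [map_mul, Pi.mul_apply] using h'
    · intro h
      apply e.injective
      funext w
      simpa only [map_mul, Pi.mul_apply] using h w
  rw [hZ]
  refine (e.toHomeomorph.isCompact_preimage).mpr (isCompact_univ_pi fun w => ?_)
  obtain ⟨g₀, l₁, l₂, hne, hγw⟩ := hell w
  exact isCompact_centralizer_archLocal_of_conj_torusMatrix w (e γ.1 w) g₀ hne hγw

/-- `CompactSpace` form of `isCompact_centralizer_of_totallyElliptic`. [cite: Rogawski1990, §3.1 p. 19] -/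
theorem compactSpace_centralizer_of_totallyElliptic
    (γ : (↥(UnitaryGroup.arch (↥(maximalRealSubfield L)) L (IsCMField.complexConj L) 2
          (Matrix.of fun i j : Fin 2 => if i.val + j.val + 1 = 2 then (1 : L) else 0)) ×
        ↥(UnitaryGroup.arch (↥(maximalRealSubfield L)) L (IsCMField.complexConj L) 1
          (Matrix.of fun i j : Fin 1 => if i.val + j.val + 1 = 1 then (1 : L) else 0))))
    (hell : ∀ w : {w : InfinitePlace L // w.IsComplex},
      ∃ (g₀ : ↥(UnitaryGroup.archLocal L 2 (Matrix.of fun i j : Fin 2 => if i.val + j.val + 1 = 2 then (1 : L) else 0) w)) (l₁ l₂ : ℂ), l₁ ≠ l₂ ∧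
        (((UnitaryGroup.archPiEquivCM 2 L (Matrix.of fun i j : Fin 2 => if i.val + j.val + 1 = 2 then (1 : L) else 0) γ.1 w :
            ↥(UnitaryGroup.archLocal L 2 (Matrix.of fun i j : Fin 2 => if i.val + j.val + 1 = 2 then (1 : L) else 0) w)) : GL (Fin 2) ℂ) : Matrix (Fin 2) (Fin 2) ℂ) =
          ((g₀ : GL (Fin 2) ℂ) : Matrix (Fin 2) (Fin 2) ℂ) * torusMatrix l₁ l₂ * (((g₀ : GL (Fin 2) ℂ)) : Matrix (Fin 2) (Fin 2) ℂ)⁻¹) :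
    CompactSpace ↥(Subgroup.centralizer ({γ} : Set ((↥(UnitaryGroup.arch (↥(maximalRealSubfield L)) L (IsCMField.complexConj L) 2
          (Matrix.of fun i j : Fin 2 => if i.val + j.val + 1 = 2 then (1 : L) else 0)) ×
        ↥(UnitaryGroup.arch (↥(maximalRealSubfield L)) L (IsCMField.complexConj L) 1
          (Matrix.of fun i j : Fin 1 => if i.val + j.val + 1 = 1 then (1 : L) else 0)))))) :=
  isCompact_iff_compactSpace.mp (isCompact_centralizer_of_totallyElliptic γ hell)

end CompactCentralizer

/-! ## §4 (ED. 3) The elliptic head WITHOUT the compactness binder -/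

section Final

variable {L : Type} [Field L] [NumberField L] [IsCMField L]
    [MeasurableSpace ((↥(UnitaryGroup.arch (↥(maximalRealSubfield L)) L (IsCMField.complexConj L) 2
          (Matrix.of fun i j : Fin 2 => if i.val + j.val + 1 = 2 then (1 : L) else 0)) ×
        ↥(UnitaryGroup.arch (↥(maximalRealSubfield L)) L (IsCMField.complexConj L) 1
          (Matrix.of fun i j : Fin 1 => if i.val + j.val + 1 = 1 then (1 : L) else 0))))]
    [BorelSpace ((↥(UnitaryGroup.arch (↥(maximalRealSubfield L)) L (IsCMField.complexConj L) 2
          (Matrix.of fun i j : Fin 2 => if i.val + j.val + 1 = 2 then (1 : L) else 0)) ×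
        ↥(UnitaryGroup.arch (↥(maximalRealSubfield L)) L (IsCMField.complexConj L) 1
          (Matrix.of fun i j : Fin 1 => if i.val + j.val + 1 = 1 then (1 : L) else 0))))]

/-- **(CONV) AT EVERY TOTALLY ELLIPTIC `G`-REGULAR CLASS — no residual binder**: as `integrable_orbitalIntegrand_of_archSchwartzGL_of_totallyElliptic` with the compactness of the
centraliser DERIVED from total ellipticity (§3).  Hypotheses left: the (W_H) frame, `G`-regularity of `c.out`, total ellipticity `hell` of `c.out`, `g ∈ 𝒞` at `Ξ`-exponent `1∕2`.
[cite: BeuzartPlessis2020Asterisque, §1.5 (1.5.2)–(1.5.3) p. 31] [cite: Rogawski1990, §4.3 (4.3.1) p. 43; §1.7 p. 6] -/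
theorem integrable_orbitalIntegrand_of_archSchwartzGL_of_totallyElliptic'
    (νH : Measure ((↥(UnitaryGroup.arch (↥(maximalRealSubfield L)) L (IsCMField.complexConj L) 2
          (Matrix.of fun i j : Fin 2 => if i.val + j.val + 1 = 2 then (1 : L) else 0)) ×
        ↥(UnitaryGroup.arch (↥(maximalRealSubfield L)) L (IsCMField.complexConj L) 1
          (Matrix.of fun i j : Fin 1 => if i.val + j.val + 1 = 1 then (1 : L) else 0)))))
    [νH.IsHaarMeasure] [νH.IsMulRightInvariant]
    [∀ a : (↥(UnitaryGroup.arch (↥(maximalRealSubfield L)) L (IsCMField.complexConj L) 2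
          (Matrix.of fun i j : Fin 2 => if i.val + j.val + 1 = 2 then (1 : L) else 0)) ×
        ↥(UnitaryGroup.arch (↥(maximalRealSubfield L)) L (IsCMField.complexConj L) 1
          (Matrix.of fun i j : Fin 1 => if i.val + j.val + 1 = 1 then (1 : L) else 0))),
      MeasurableSpace ((↥(UnitaryGroup.arch (↥(maximalRealSubfield L)) L (IsCMField.complexConj L) 2
          (Matrix.of fun i j : Fin 2 => if i.val + j.val + 1 = 2 then (1 : L) else 0)) ×
        ↥(UnitaryGroup.arch (↥(maximalRealSubfield L)) L (IsCMField.complexConj L) 1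
          (Matrix.of fun i j : Fin 1 => if i.val + j.val + 1 = 1 then (1 : L) else 0))) ⧸ Subgroup.centralizer ({a} : Set _))]
    [∀ a : (↥(UnitaryGroup.arch (↥(maximalRealSubfield L)) L (IsCMField.complexConj L) 2
          (Matrix.of fun i j : Fin 2 => if i.val + j.val + 1 = 2 then (1 : L) else 0)) ×
        ↥(UnitaryGroup.arch (↥(maximalRealSubfield L)) L (IsCMField.complexConj L) 1
          (Matrix.of fun i j : Fin 1 => if i.val + j.val + 1 = 1 then (1 : L) else 0))),
      BorelSpace ((↥(UnitaryGroup.arch (↥(maximalRealSubfield L)) L (IsCMField.complexConj L) 2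
          (Matrix.of fun i j : Fin 2 => if i.val + j.val + 1 = 2 then (1 : L) else 0)) ×
        ↥(UnitaryGroup.arch (↥(maximalRealSubfield L)) L (IsCMField.complexConj L) 1
          (Matrix.of fun i j : Fin 1 => if i.val + j.val + 1 = 1 then (1 : L) else 0))) ⧸ Subgroup.centralizer ({a} : Set _))]
    (tH : ∀ γH : (↥(UnitaryGroup.arch (↥(maximalRealSubfield L)) L (IsCMField.complexConj L) 2
          (Matrix.of fun i j : Fin 2 => if i.val + j.val + 1 = 2 then (1 : L) else 0)) ×
        ↥(UnitaryGroup.arch (↥(maximalRealSubfield L)) L (IsCMField.complexConj L) 1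
          (Matrix.of fun i j : Fin 1 => if i.val + j.val + 1 = 1 then (1 : L) else 0))),
      Measure ↥(Subgroup.centralizer ({γH} : Set _)))
    (mH : OrbitalMeasureFamily ((↥(UnitaryGroup.arch (↥(maximalRealSubfield L)) L (IsCMField.complexConj L) 2
          (Matrix.of fun i j : Fin 2 => if i.val + j.val + 1 = 2 then (1 : L) else 0)) ×
        ↥(UnitaryGroup.arch (↥(maximalRealSubfield L)) L (IsCMField.complexConj L) 1
          (Matrix.of fun i j : Fin 1 => if i.val + j.val + 1 = 1 then (1 : L) else 0)))))
    (hW : mH.IsQuotientOf (IsArchGRegular L) νH tH)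
    (𝔩 : Set (Matrix (Fin 3) (Fin 3) (mixedSpace L)))
    {g : (↥(UnitaryGroup.arch (↥(maximalRealSubfield L)) L (IsCMField.complexConj L) 2
          (Matrix.of fun i j : Fin 2 => if i.val + j.val + 1 = 2 then (1 : L) else 0)) ×
        ↥(UnitaryGroup.arch (↥(maximalRealSubfield L)) L (IsCMField.complexConj L) 1
          (Matrix.of fun i j : Fin 1 => if i.val + j.val + 1 = 1 then (1 : L) else 0))) → ℂ}
    (hg : ArchSchwartzGL L 3 𝔩 (1 / (2 : ℝ)) (fun k => ((endoEmbArch L k).val : GL (Fin 3) (mixedSpace L))) g)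
    (c : ConjClasses ((↥(UnitaryGroup.arch (↥(maximalRealSubfield L)) L (IsCMField.complexConj L) 2
          (Matrix.of fun i j : Fin 2 => if i.val + j.val + 1 = 2 then (1 : L) else 0)) ×
        ↥(UnitaryGroup.arch (↥(maximalRealSubfield L)) L (IsCMField.complexConj L) 1
          (Matrix.of fun i j : Fin 1 => if i.val + j.val + 1 = 1 then (1 : L) else 0)))))
    (hc : IsArchGRegular L (Quotient.out c))
    (hell : ∀ w : {w : InfinitePlace L // w.IsComplex},
      ∃ (g₀ : ↥(UnitaryGroup.archLocal L 2 (Matrix.of fun i j : Fin 2 => if i.val + j.val + 1 = 2 then (1 : L) else 0) w)) (l₁ l₂ : ℂ), l₁ ≠ l₂ ∧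
        (((UnitaryGroup.archPiEquivCM 2 L (Matrix.of fun i j : Fin 2 => if i.val + j.val + 1 = 2 then (1 : L) else 0) (Quotient.out c).1 w :
            ↥(UnitaryGroup.archLocal L 2 (Matrix.of fun i j : Fin 2 => if i.val + j.val + 1 = 2 then (1 : L) else 0) w)) : GL (Fin 2) ℂ) : Matrix (Fin 2) (Fin 2) ℂ) =
          ((g₀ : GL (Fin 2) ℂ) : Matrix (Fin 2) (Fin 2) ℂ) * torusMatrix l₁ l₂ * (((g₀ : GL (Fin 2) ℂ)) : Matrix (Fin 2) (Fin 2) ℂ)⁻¹) :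
    Integrable (descConj (Quotient.out c) (Subgroup.centralizer ({Quotient.out c} : Set _))
      (fun _ h => Subgroup.mem_centralizer_singleton_iff.1 h) g) (mH c) := by
  haveI := compactSpace_centralizer_of_totallyElliptic (Quotient.out c) hell
  exact integrable_orbitalIntegrand_of_archSchwartzGL_of_totallyElliptic νH tH mH hW 𝔩 hg c hc hell

end Final

end Literature.NumberTheory.Rogawski1990

end
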